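import Literature.NumberTheory.PAdicHodge.UnramifiedWittVectors
import Literature.NumberTheory.PAdicHodge.BdRField
import HarnessLib

/-!
# `W(k̄) → B_dR⁺(F) → B_dR(F)`, `Γ_F`-equivariantly and compatibly with `ℚ_p` and `θ`

Let `F` be a non-archimedean local field of characteristic `0` and residue characteristic `p`,
`k̄ = ResidueField 𝒪̂_{F^nr}` (file `UnramifiedWittVectors`), `𝔸_inf(F) = W(𝒪_{ℂ_F}♭)`,
`B_dR⁺(F)` (files `BdRPlusGalois`, `BdRPlusTheta`) and `B_dR(F) = Frac B_dR⁺(F)` (file `BdRField`).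
This file records the glue that makes `B_dR` (and every period ring between `𝔸_inf` and `B_dR`)
a period ring *receiving `W(k̄)`* in the sense of `PeriodRingData.isAdmissible_of_unramified_witt`
(file `UnramifiedWittPeriodMatrix`), i.e. the input of clause (F3) "unramified ⇒ de Rham" of
`IsFontaineDatum` for Fontaine's rings:

* `wittToBdRPlus : W(k̄) →+* B_dR⁺(F)` — `𝔸_inf → B_dR⁺` after `W(k̄) → 𝔸_inf` (`wittToAinf`);
* `galBdRPlus_wittToBdRPlus`, `smul_wittToBdRPlus` — **`Γ_F`-equivariance**: `σ (ι x) = ι (𝕎(σ̄) x)`;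
* `wittToBdRPlus_eq_qpToBdR` — **compatibility with `ℚ_p → B_dR⁺`**: for ANY ring map
  `φ : ℤ_p → W(k̄)`, `ι (φ z) = qpToBdR z` (ring maps `ℤ_p → 𝔸_inf` are unique);
* `thetaBdR_wittToBdRPlus` — **compatibility with `θ`**: `θ (ι x)` is the image in `ℂ_F` of
  `x ∈ W(k̄) ⊆ 𝒪̂_{F^nr}` (`wittToCompletion`);
* `wittToFracBdR : W(k̄) →+* B_dR(F)` with `smul_wittToFracBdR`, `wittToFracBdR_eq`;
* `wittToFracBdR_mem_fil_zero` — **(H0)** `ι(W(k̄)) ⊆ Fil⁰ B_dR`;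
* `eq_zero_of_sum_smul_wittToFracBdR_mem_fil_one` — **(H1)** for invertible `X ∈ M_N(W(k̄))` and
  `c ∈ F^N`, `Σ_j c_j ι(X_{kj}) ∈ Fil¹ B_dR` for all `k` forces `c = 0` (apply `θ`).
(H0), (H1) are exactly the hypotheses of `PeriodRingData.finrank_filD_of_unramified_witt` /
`hodgeTateWeights_of_unramified_witt` (file `UnramifiedWittWeights`): unramified ⇒ all Hodge–Tate
weights `0` for `B_dR`.

(Fontaine 1994, Exp. II §1.5 and Exp. III §1.5: `P₀ = W(k̄)[1/p] ⊆ B_dR⁺` stably under `G_K`.)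
No new definitions beyond the two composites; no named facts.

## References
* [FontaineAsterisque223III] J.-M. Fontaine, Astérisque 223 (1994), Exp. II §1.2, §1.5; Exp. III §1.5.
* [FontaineOuyang2022] J.-M. Fontaine, Y. Ouyang, *Theory of p-adic Galois representations*, §4.4, Prop. 2.14.
-/

noncomputable section

open WittVector IsLocalRing Field ValuativeRel Matrix
open scoped ValuativeRel

namespace Literature.NumberTheory.PAdicHodge

open Literature.NumberTheory.GaloisRepresentations
open Literature.NumberTheory.GaloisRepresentations.IsNonarchimedeanLocalField

variable {F : Type} [Field F] [ValuativeRel F] [TopologicalSpace F] [IsNonarchimedeanLocalField F]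
  [CharZero F] {p : ℕ} [Fact p.Prime] [Fact (¬ IsUnit (p : maxUnramifiedCompletion F))]
  [CharP (ResidueField (maxUnramifiedCompletion F)) p] [Fact (¬ IsUnit (p : integerC F))]
  [IsAdicComplete (Ideal.span {(p : integerC F)}) (integerC F)]

/-! ### `W(k̄) → B_dR⁺(F)` -/

variable (F p) in
/-- **`W(k̄) → B_dR⁺(F)`**: the composite `W(k̄) → 𝔸_inf(F) → B_dR⁺(F)` (`wittToAinf`, `ainfToBdR`).
[cite: FontaineAsterisque223III, Exp. II §1.5] -/
def wittToBdRPlus : WittVector p (ResidueField (maxUnramifiedCompletion F)) →+* BDeRhamPlus (integerC F) p :=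
  (ainfToBdR (F := F) (p := p)).comp (wittToAinf F p)

/-- Unfolding of `wittToBdRPlus`. [folklore] -/
theorem wittToBdRPlus_apply (x : WittVector p (ResidueField (maxUnramifiedCompletion F))) :
    wittToBdRPlus F p x = ainfToBdR (wittToAinf F p x) := rfl

/-- **`W(k̄) → B_dR⁺(F)` is `Γ_F`-equivariant**: `σ (ι x) = ι (𝕎(σ̄) x)` (equivariance of
`W(k̄) → 𝔸_inf`, `galAinf_wittToAinf`, and of `𝔸_inf → B_dR⁺`, `galBdRPlus_ainfToBdR`).
[cite: FontaineAsterisque223III, Exp. II §1.5.5] -/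
theorem galBdRPlus_wittToBdRPlus (σ : absoluteGaloisGroup F) (x : WittVector p (ResidueField (maxUnramifiedCompletion F))) :
    galBdRPlus σ (wittToBdRPlus F p x) = wittToBdRPlus F p (WittVector.map (residueGal σ) x) := by
  rw [wittToBdRPlus_apply, galBdRPlus_ainfToBdR, galAinf_wittToAinf, wittToBdRPlus_apply]

/-- The same for the `MulSemiringAction` of `Γ_F` on `B_dR⁺(F)`. [cite: FontaineAsterisque223III, Exp. II §1.5.5] -/
theorem smul_wittToBdRPlus (σ : absoluteGaloisGroup F) (x : WittVector p (ResidueField (maxUnramifiedCompletion F))) :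
    σ • wittToBdRPlus F p x = wittToBdRPlus F p (WittVector.map (residueGal σ) x) := by
  rw [smul_bdRPlus_def, galBdRPlus_wittToBdRPlus]

/-- **`W(k̄) → B_dR⁺(F)` is a map of `ℤ_p`-algebras**: for every ring map `φ : ℤ_p → W(k̄)` (there is
exactly one), `ι (φ z) = qpToBdR z` — ring maps `ℤ_p → 𝔸_inf(F)` are unique (`𝔸_inf` is `p`-adically
separated, `padicInt_ringHom_ext_of_isHausdorff`) and `qpToBdR` extends `ℤ_p → 𝔸_inf → B_dR⁺`.
[cite: FontaineOuyang2022, §4.4] -/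
theorem wittToBdRPlus_eq_qpToBdR (φ : ℤ_[p] →+* WittVector p (ResidueField (maxUnramifiedCompletion F))) (z : ℤ_[p]) :
    wittToBdRPlus F p (φ z) = qpToBdR (z : ℚ_[p]) := by
  rw [qpToBdR_coe, wittToBdRPlus_apply]
  exact congrArg ainfToBdR
    (RingHom.congr_fun (padicInt_ringHom_ext_of_isHausdorff ((wittToAinf F p).comp φ) zpToAinf) z)

/-- **`θ ∘ (W(k̄) → B_dR⁺) = (W(k̄) → 𝒪̂_{F^nr} → ℂ_F)`**: on `W(k̄)` Fontaine's `θ` is the canonical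
embedding (`coe_fontaineTheta_wittToAinf`, `thetaBdR_ainfToBdR`). [cite: FontaineAsterisque223III, Exp. II §1.5.2] -/
theorem thetaBdR_wittToBdRPlus [IsAdicComplete (Ideal.span {(p : maxUnramifiedCompletion F)}) (maxUnramifiedCompletion F)]
    (x : WittVector p (ResidueField (maxUnramifiedCompletion F))) :
    thetaBdR (wittToBdRPlus F p x) = maxUnramifiedCompletion.toC F (wittToCompletion F p x) := by
  rw [wittToBdRPlus_apply, thetaBdR_ainfToBdR, coe_fontaineTheta_wittToAinf]

/-! ### `W(k̄) → B_dR(F)` -/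

variable (F p) in
/-- **`W(k̄) → B_dR(F) = Frac B_dR⁺(F)`**. [cite: FontaineAsterisque223III, Exp. II §1.5.5] -/
def wittToFracBdR : WittVector p (ResidueField (maxUnramifiedCompletion F)) →+* FracBdR F p :=
  (algebraMap (BDeRhamPlus (integerC F) p) (FracBdR F p)).comp (wittToBdRPlus F p)

/-- Unfolding of `wittToFracBdR`. [folklore] -/
theorem wittToFracBdR_apply (x : WittVector p (ResidueField (maxUnramifiedCompletion F))) :
    wittToFracBdR F p x = algebraMap (BDeRhamPlus (integerC F) p) (FracBdR F p) (wittToBdRPlus F p x) := rfl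

/-- **`W(k̄) → B_dR(F)` is `Γ_F`-equivariant.** [cite: FontaineAsterisque223III, Exp. II §1.5.5] -/
theorem smul_wittToFracBdR (σ : absoluteGaloisGroup F) (x : WittVector p (ResidueField (maxUnramifiedCompletion F))) :
    σ • wittToFracBdR F p x = wittToFracBdR F p (WittVector.map (residueGal σ) x) := by
  rw [wittToFracBdR_apply, smul_algebraMap_fracBdR, galBdRPlus_wittToBdRPlus, wittToFracBdR_apply]

/-- **`W(k̄) → B_dR(F)` is compatible with `ℚ_p → B_dR⁺ → B_dR`** (for every `φ : ℤ_p → W(k̄)`).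
[cite: FontaineOuyang2022, §4.4] -/
theorem wittToFracBdR_eq (φ : ℤ_[p] →+* WittVector p (ResidueField (maxUnramifiedCompletion F))) (z : ℤ_[p]) :
    wittToFracBdR F p (φ z) = algebraMap (BDeRhamPlus (integerC F) p) (FracBdR F p) (qpToBdR (z : ℚ_[p])) := by
  rw [wittToFracBdR_apply, wittToBdRPlus_eq_qpToBdR]


/-! ### `ι(W(k̄)) ⊆ Fil⁰ B_dR` and `Fil¹ B_dR` detects `θ ∘ ι` -/

section Fil

variable (hp : valuation F p < 1) (hF : Function.Surjective (fontaineTheta (integerC F) p))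
  [IsDomain (BDeRhamPlus (integerC F) p)]

/-- **(H0) `ι(W(k̄)) ⊆ B_dR⁺ = Fil⁰ B_dR`.** [cite: FontaineAsterisque223III, Exp. II §1.5.5] -/
theorem wittToFracBdR_mem_fil_zero (x : WittVector p (ResidueField (maxUnramifiedCompletion F))) :
    letI := fracAlgebra (p := p) hp hF; wittToFracBdR F p x ∈ fil hp hF 0 :=
  algebraMap_mem_fil_zero hp hF _

/-- **(H1) `Fil¹ B_dR` detects `θ ∘ ι`**: if `X ∈ M_N(W(k̄))` is invertible, `c ∈ F^N`, and
`Σ_j c_j ι(X_{kj}) ∈ Fil¹ B_dR = ξ B_dR⁺` for every `k`, then `c = 0` — apply `θ` (which kills `ξ`,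
is `F`-linear, and restricts on `W(k̄)` to the embedding into `ℂ_F`): `θ(ι(X)) · c = 0` with
`θ(ι(X))` invertible over `ℂ_F`.  This is the input "`Fil¹ D_dR(V) = 0`" for unramified `V`
(Fontaine 1994, Exp. III §5). [cite: FontaineAsterisque223III, Exp. III §5] -/
theorem eq_zero_of_sum_smul_wittToFracBdR_mem_fil_one
    [IsAdicComplete (Ideal.span {(p : maxUnramifiedCompletion F)}) (maxUnramifiedCompletion F)]
    {N : ℕ} {X : Matrix (Fin N) (Fin N) (WittVector p (ResidueField (maxUnramifiedCompletion F)))}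
    (hX : IsUnit X) {c : Fin N → F}
    (h : ∀ k, (letI := fracAlgebra (p := p) hp hF; (∑ j, c j • wittToFracBdR F p (X k j)) ∈ fil hp hF 1)) :
    c = 0 := by
  classical
  letI := fracAlgebra (p := p) hp hF
  -- the image of `X` in `M_N(ℂ_F)` is invertible
  set Y : Matrix (Fin N) (Fin N) (CompletedAlgClosure F) :=
    ((maxUnramifiedCompletion.toC F).comp (wittToCompletion F p)).mapMatrix X with hY
  have hYu : IsUnit Y := hX.map _
  set d : Fin N → CompletedAlgClosure F := fun j => algebraMap F (CompletedAlgClosure F) (c j) with hd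
  have hd0 : Y.mulVec d = 0 := by
    funext k
    obtain ⟨b, hb⟩ := (mem_fil_iff hp hF).1 (h k)
    have hsum : (∑ j, c j • wittToFracBdR F p (X k j)) =
        algebraMap (BDeRhamPlus (integerC F) p) (FracBdR F p)
          (∑ j, embBdRHom hp hF (c j) * wittToBdRPlus F p (X k j)) := by
      rw [map_sum]
      refine Finset.sum_congr rfl fun j _ => ?_
      rw [Algebra.smul_def, algebraMap_fracAlgebra, wittToFracBdR_apply, map_mul]
    rw [hsum, zpow_one, ← map_mul] at hb
    have hθ := congrArg thetaBdR (algebraMap_fracBdR_injective hb)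
    rw [map_mul, thetaBdR_xiBdR, zero_mul, map_sum] at hθ
    rw [Pi.zero_apply, ← hθ, Matrix.mulVec, dotProduct]
    refine Finset.sum_congr rfl fun j _ => ?_
    rw [map_mul, thetaBdR_embBdRHom, thetaBdR_wittToBdRPlus, mul_comm]
    rfl
  have hdz : d = 0 := Matrix.mulVec_injective_of_isUnit hYu (by rw [hd0, Matrix.mulVec_zero])
  funext j
  have := congrFun hdz j
  simp only [hd, Pi.zero_apply, map_eq_zero] at this
  exact this

end Fil

end Literature.NumberTheory.PAdicHodge

end
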